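import Literature.AlgebraicGeometry.Resolution.KangarooAtlasCertDMC

/-!
# Digit-pair arithmetic over `GF(p²)` and the ideal-equality certificate checker used by the depth-2 germ certificates over `GF(p²)`
(observatory `pub-rosobs`, unit `pub-rosobs-eng1-g7`; kit module shared by `ClosedPts4CertP3D2E2`, `…P5D2E2`, `…P7D2E2`).

ENCODING (mirrors `KangarooAtlasCertDMC.Poly`): an element of `K₀ = 𝔽_p[θ]/(θ² − u·θ − v)` is the digit pair `(a₀, a₁) = a₀ + a₁θ`;
`irreducible2 p u v` re-checks that `θ² − uθ − v` has no root in `𝔽_p`; `idealEqCert2` is the two-way cofactor certificate `(F) = (G)` in `K₀[b]`.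
FILING NOTE (pub-rosobs-filer, 2026-08-20): this is the helper preamble that the three staged files
`pub-rosobs-eng1-g7/lean/ClosedPts4CertP{3,5,7}D2E2.lean` each carried verbatim (identical text in all three, generator `code/eng1g7/gbcert_ext2.py`),
moved to one module so that it is declared once; docstrings added where the staged text had none. Nothing about resolution of singularities.
-/

namespace Summit.ResolutionOfSingularities.KangarooAtlas.ClosedPts4CertExt2Kit
open Literature.AlgebraicGeometry.Resolution.KangarooAtlasCertDMC

set_option maxRecDepth 200000

/-- element `a₀ + a₁θ` of `GF(p²) = 𝔽_p[θ]/(θ² − uθ − v)` as a digit pair. [folklore] -/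
abbrev Coef2 := ℤ × ℤ
/-- sparse polynomial over `GF(p²)`. [folklore] -/
abbrev Poly2 := List (Mon × Coef2)
/-- reduce both digits mod `p`. [folklore] -/
def red2 (p : ℕ) (c : Coef2) : Coef2 := (c.1 % (p : ℤ), c.2 % (p : ℤ))
/-- digit-pair addition (before reduction). [folklore] -/
def add2 (x y : Coef2) : Coef2 := (x.1 + y.1, x.2 + y.2)
/-- `(x₀ + x₁θ)(y₀ + y₁θ)` with `θ² = uθ + v`. [folklore] -/
def mul2 (u v : ℤ) (x y : Coef2) : Coef2 := (x.1 * y.1 + v * x.2 * y.2, x.1 * y.2 + x.2 * y.1 + u * x.2 * y.2)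
/-- the zero test on a (reduced) digit pair. [folklore] -/
def isZero2 (c : Coef2) : Bool := (c.1 == 0) && (c.2 == 0)
/-- insert one term into a sparse `GF(p²)` polynomial, merging equal monomials and dropping zeros (mirror of `KangarooAtlasCertDMC.addTerm`). [folklore] -/
def addTerm2 (p : ℕ) (t : Mon × Coef2) : Poly2 → Poly2
  | [] => if isZero2 (red2 p t.2) then [] else [(t.1, red2 p t.2)]
  | (m, c) :: rest =>
      if m = t.1 then (if isZero2 (red2 p (add2 c t.2)) then rest else (m, red2 p (add2 c t.2)) :: rest)
      else (m, c) :: addTerm2 p t rest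
/-- normal form of a sparse `GF(p²)` polynomial (mirror of `KangarooAtlasCertDMC.normalize`). [folklore] -/
def normalize2 (p : ℕ) (P : Poly2) : Poly2 := P.foldl (fun acc t => addTerm2 p t acc) []
/-- product of sparse `GF(p²)` polynomials, `θ² = uθ + v`. [folklore] -/
def polyMul2 (p : ℕ) (u v : ℤ) (P Q : Poly2) : Poly2 :=
  normalize2 p (P.flatMap fun s => Q.map fun t => (List.zipWith (· + ·) s.1 t.1, red2 p (mul2 u v s.2 t.2)))
/-- `−P` coefficientwise over `GF(p²)`. [folklore] -/
def pneg2 (P : Poly2) : Poly2 := P.map fun t => (t.1, (-t.2.1, -t.2.2))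
/-- `Σ_i cs[i] · fs[i]` over `GF(p²)[b]`, normalised. [folklore] -/
def linComb2 (p : ℕ) (u v : ℤ) (cs fs : List Poly2) : Poly2 := normalize2 p ((List.zipWith (polyMul2 p u v) cs fs).foldr (· ++ ·) [])
/-- `P = Q` in `GF(p²)[b]` (as normalised sparse polynomials). [folklore] -/
def eqMod2 (p : ℕ) (P Q : Poly2) : Bool := (normalize2 p (P ++ pneg2 Q)).isEmpty
/-- ideal-equality certificate over `GF(p²)[b]`: `|C| = |G|`, `|Q| = |F|`, every `G_j = Σ_i C[j][i]·F_i` and every `F_i = Σ_j Q[i][j]·G_j`. [folklore] -/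
def idealEqCert2 (p : ℕ) (u v : ℤ) (F G : List Poly2) (C Q : List (List Poly2)) : Bool :=
  (C.length == G.length) && (Q.length == F.length) &&
  (List.zipWith (fun g cs => eqMod2 p g (linComb2 p u v cs F)) G C).all id &&
  (List.zipWith (fun f qs => eqMod2 p f (linComb2 p u v qs G)) F Q).all id
/-- `θ² − uθ − v` has no root in `𝔽_p` (so the digit-pair arithmetic is the field `GF(p²)`). [folklore] -/
def irreducible2 (p : ℕ) (u v : ℤ) : Bool := (List.range p).all fun a => ((a : ℤ) * a - u * a - v) % (p : ℤ) != 0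

end Summit.ResolutionOfSingularities.KangarooAtlas.ClosedPts4CertExt2Kit
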